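import Mathlib.RepresentationTheory.Maschke
import Mathlib.RepresentationTheory.Semisimple
import Mathlib.Analysis.Complex.Polynomial.Basic
import Literature.NumberTheory.GaloisRepresentations.WeilDeligneRepFrobSemisimpleProofs
import Literature.NumberTheory.GaloisRepresentations.WeilGroupIrreducibleTwist
import Literature.RepresentationTheory.Semisimple.Twist
import HarnessLib

/-!
# Generic Weil–Deligne representations form one orbit, II: semisimplicity of the twisted Weil action

Representation-theoretic tools for the discharge (`GenericWeilDeligneOrbitProofs`) of the named
fact `WeilDeligneRep.AHTW2026_prop_6_0_5_generic_conj` (A'Campo–Hevesi–Thorne–Whitmore,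
arXiv:2607.11763, Prop. 6.0.5 (1)–(2)), all proved:

* `isSemisimpleRepresentation_of_finite_range` — Maschke for complex representations with finite
  image (the invariant subspaces are those of the finite group `ρ(G)`);
* `finite_range_of_frobenius_decomposition` — finite image from `W = Φ^ℤ I`, `τ(Φ)` of finite
  order and `τ(I)` finite;
* `isSemisimpleRepresentation_of_frobenius_scalar` — a subrepresentation of a representation of
  the Weil group `W_F` taking finitely many values on inertia, on which a Frobenius power `Φᵐ`
  acts by a non-zero scalar `λ`, is semisimple: twisting by the unramified character
  `w ↦ ν^{-deg w}` (`νᵐ = λ`, `WeilGroup.zpowDegChar`) gives a representation with finite image,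
  and twisting does not change invariant subspaces
  (`Literature.RepresentationTheory.Semisimple.Representation.isSemisimpleRepresentation_twist_iff`).

This is the classical input "`ρ(I_K)` is finite and a power of Frobenius is central, so a
Frobenius-semisimple Weil representation is semisimple" (Deligne, *Les constantes des équations
fonctionnelles des fonctions L*, Antwerp II, LNM 349 (1973), §8; Tate, Corvallis (4.1.3)).

## References

* L. A'Campo, B. Hevesi, J. A. Thorne, D. Whitmore, arXiv:2607.11763 (2026), §6. [AHTW2026]
* P. Deligne, Antwerp II, LNM 349 (1973), 8.4.1. [Deligne1973Constantes]
-/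

namespace Literature.NumberTheory.GaloisRepresentations

namespace WeilDeligneRep

open Module

/-- **Maschke for finite image.**  A complex representation of a group with finite image is
semisimple (its invariant subspaces are those of the finite group `ρ(G)`). [folklore] -/
theorem isSemisimpleRepresentation_of_finite_range {G : Type*} [Group G] {E : Type*}
    [AddCommGroup E] [Module ℂ E] (σ : Representation ℂ G E) (hfin : (Set.range σ).Finite) :
    σ.IsSemisimpleRepresentation := by
  let H : Subgroup (E →ₗ[ℂ] E)ˣ := σ.asGroupHom.range
  have hH : (Set.range σ.asGroupHom).Finite := by
    refine Set.Finite.of_finite_image (f := (Units.val : (E →ₗ[ℂ] E)ˣ → E →ₗ[ℂ] E)) ?_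
      Units.val_injective.injOn
    refine hfin.subset ?_
    rintro _ ⟨_, ⟨g, rfl⟩, rfl⟩
    exact ⟨g, (σ.asGroupHom_apply g).symm⟩
  haveI : Finite H := by
    have : (H : Set (E →ₗ[ℂ] E)ˣ).Finite := by
      rw [MonoidHom.coe_range]; exact hH
    exact this.to_subtype
  haveI : NeZero (Nat.card H : ℂ) := ⟨Nat.cast_ne_zero.mpr Nat.card_pos.ne'⟩
  let σH : Representation ℂ H E := (Units.coeHom (E →ₗ[ℂ] E)).comp H.subtype
  let e : Subrepresentation σ ≃o Subrepresentation σH :=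
    { toFun := fun W ↦ ⟨W.toSubmodule, fun h v hv ↦ by
        obtain ⟨g, hg⟩ := h.2
        have : σH h = σ g := by
          change ((h : (E →ₗ[ℂ] E)ˣ) : E →ₗ[ℂ] E) = σ g
          rw [← hg, Representation.asGroupHom_apply]
        rw [this]
        exact W.apply_mem_toSubmodule g hv⟩
      invFun := fun W ↦ ⟨W.toSubmodule, fun g v hv ↦ by
        have : σ g = σH ⟨σ.asGroupHom g, g, rfl⟩ := by
          change σ g = ((σ.asGroupHom g : (E →ₗ[ℂ] E)ˣ) : E →ₗ[ℂ] E)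
          rw [Representation.asGroupHom_apply]
        rw [this]
        exact W.apply_mem_toSubmodule _ hv⟩
      left_inv := fun W ↦ by ext; rfl
      right_inv := fun W ↦ by ext; rfl
      map_rel_iff' := Iff.rfl }
  exact e.complementedLattice_iff.mpr inferInstance

/-- **Finite image from a Frobenius of finite order and finitely many inertia values.**  If
every `w` is `Φ ^ z * i` with `i ∈ I`, `τ(Φ)` has finite order `m` and `τ(I)` is finite, then
`τ` has finite image. [folklore] -/
theorem finite_range_of_frobenius_decomposition {G M : Type*} [Group G] [Group M] (τ : G →* M)
    (Φ : G) {m : ℕ} (hm : 0 < m) (hΦm : τ Φ ^ m = 1) (I : Set G)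
    (hdec : ∀ w, ∃ z : ℤ, ∃ i ∈ I, w = Φ ^ z * i) (hI : (τ '' I).Finite) :
    (Set.range τ).Finite := by
  classical
  have hfin : ((fun p : ℕ × M => τ Φ ^ p.1 * p.2) '' ((Finset.range m : Set ℕ) ×ˢ (τ '' I))).Finite :=
    ((Finset.finite_toSet _).prod hI).image _
  refine hfin.subset ?_
  rintro _ ⟨w, rfl⟩
  obtain ⟨z, i, hi, rfl⟩ := hdec w
  refine ⟨((z % m).toNat, τ i), ⟨?_, ⟨i, hi, rfl⟩⟩, ?_⟩
  · have h1 : 0 ≤ z % m := Int.emod_nonneg _ (by exact_mod_cast hm.ne')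
    have h2 : z % m < m := Int.emod_lt_of_pos _ (by exact_mod_cast hm)
    simp only [Finset.coe_range, Set.mem_Iio]
    omega
  · change τ Φ ^ (z % (m : ℤ)).toNat * τ i = τ (Φ ^ z * i)
    rw [map_mul, map_zpow, zpow_eq_zpow_emod' z hΦm, ← zpow_natCast,
      Int.toNat_of_nonneg (Int.emod_nonneg _ (by exact_mod_cast hm.ne'))]

section FrobeniusScalar

open GaloisRepresentations.IsNonarchimedeanLocalField WeilGroup

variable {F : Type*} [Field F] [ValuativeRel F] [TopologicalSpace F] [IsNonarchimedeanLocalField F]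

/-- **Semisimplicity of a Weil-group representation on which a Frobenius power is scalar.**
Let `τ` be a representation of `W_F` on a complex vector space whose values on inertia form a
finite set, and `E` a subrepresentation on which `τ(Φᵐ)` (`deg Φ = 1`, `m ≥ 1`) acts by a
non-zero scalar `λ`.  Then `E` is semisimple: twisting by the unramified character
`w ↦ ν^{-deg w}`, `νᵐ = λ`, gives a representation with finite image (`W_F = Φ^ℤ I_F`), which
is semisimple by Maschke, and twisting does not change the invariant subspaces. [folklore] -/
theorem isSemisimpleRepresentation_of_frobenius_scalar {V : Type*} [AddCommGroup V] [Module ℂ V]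
    (τ : Representation ℂ (WeilGroup F) V) {Φ : WeilGroup F} (hΦ : deg Φ = 1) {m : ℕ} (hm : 0 < m)
    (E : Subrepresentation τ) {lam : ℂ} (hlam : lam ≠ 0)
    (hE : ∀ x ∈ E.toSubmodule, τ (Φ ^ m) x = lam • x)
    (hfinI : ((fun w => τ w) '' (inertia F : Set (WeilGroup F))).Finite) :
    E.toRepresentation.IsSemisimpleRepresentation := by
  classical
  have hdegΦm : deg (Φ ^ m) = m := by rw [deg_pow, hΦ, mul_one]
  have hdecomp : ∀ w : WeilGroup F, w = Φ ^ (deg w) * (Φ ^ (-deg w) * w) := fun w => by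
    rw [← mul_assoc, zpow_neg, mul_inv_cancel, one_mul]
  set σ := E.toRepresentation with hσ
  have hσapp : ∀ w (x : E.toSubmodule), (σ w x : V) = τ w (x : V) := fun w x => rfl
  have hσΦm : ∀ x : E.toSubmodule, (σ (Φ ^ m) x : V) = lam • (x : V) := fun x => by
    rw [hσapp]; exact hE x x.2
  obtain ⟨ν, hν⟩ := IsAlgClosed.exists_pow_nat_eq lam hm
  have hν0 : ν ≠ 0 := by
    rintro rfl
    rw [zero_pow hm.ne'] at hν
    exact hlam hν.symm
  let χ : WeilGroup F →* ℂˣ := zpowDegChar F (Units.mk0 ν hν0)⁻¹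
  have hχval : ∀ w, ((χ w : ℂˣ) : ℂ) = ν⁻¹ ^ (deg w) := fun w => by
    change (((zpowDegChar F (Units.mk0 ν hν0)⁻¹) w : ℂˣ) : ℂ) = _
    rw [zpowDegChar_apply, Units.val_zpow_eq_zpow_val, Units.val_inv_eq_inv_val, Units.val_mk0]
  set σ' := Literature.RepresentationTheory.Semisimple.Representation.twist σ χ with hσ'
  have hσ'app : ∀ w (x : E.toSubmodule), (σ' w x : V) = ((χ w : ℂˣ) : ℂ) • τ w (x : V) :=
    fun w x => rfl
  -- `σ'` on inertia only depends on `τ`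
  have hkey : ∀ i ∈ inertia F, ∀ i' ∈ inertia F, τ i = τ i' →
      σ'.asGroupHom i = σ'.asGroupHom i' := by
    intro i hi i' hi' h
    apply Units.ext
    rw [Representation.asGroupHom_apply, Representation.asGroupHom_apply]
    apply LinearMap.ext
    intro x
    apply Subtype.ext
    rw [hσ'app, hσ'app, h]
    change (((zpowDegChar F (Units.mk0 ν hν0)⁻¹) i : ℂˣ) : ℂ) • _ =
      (((zpowDegChar F (Units.mk0 ν hν0)⁻¹) i' : ℂˣ) : ℂ) • _
    rw [zpowDegChar_eq_one_of_mem_inertia _ hi, zpowDegChar_eq_one_of_mem_inertia _ hi']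
  -- `σ'` has finite image
  have hfinite : (Set.range σ').Finite := by
    have hτ : (Set.range σ'.asGroupHom).Finite := by
      refine finite_range_of_frobenius_decomposition σ'.asGroupHom Φ hm ?_
        (inertia F : Set (WeilGroup F))
        (fun w => ⟨deg w, _, zpow_neg_deg_mul_mem_inertia hΦ w, hdecomp w⟩) ?_
      · -- `σ'(Φ)` has order dividing `m`
        apply Units.ext
        rw [← map_pow, Representation.asGroupHom_apply, Units.val_one]
        apply LinearMap.ext
        intro x
        apply Subtype.ext
        rw [hσ'app, ← hσapp, hσΦm x, smul_smul, hχval, hdegΦm]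
        have : ν⁻¹ ^ (m : ℤ) * lam = 1 := by
          rw [← hν, zpow_natCast, inv_pow, inv_mul_cancel₀ (pow_ne_zero m hν0)]
        rw [this, one_smul]
        rfl
      · -- finitely many values on inertia
        have hrep : ∀ A ∈ (fun w => τ w) '' (inertia F : Set (WeilGroup F)),
            ∃ i ∈ (inertia F : Set (WeilGroup F)), τ i = A := fun A hA => hA
        choose! rep hrep_mem hrep_eq using hrep
        refine ((hfinI.image rep).image σ'.asGroupHom).subset ?_
        rintro _ ⟨i, hi, rfl⟩
        refine ⟨rep (τ i), ⟨_, ⟨i, hi, rfl⟩, rfl⟩, ?_⟩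
        exact hkey _ (hrep_mem _ ⟨i, hi, rfl⟩) i hi (hrep_eq _ ⟨i, hi, rfl⟩)
    have hr : Set.range σ' = Units.val '' Set.range σ'.asGroupHom := by
      ext A
      constructor
      · rintro ⟨w, rfl⟩
        exact ⟨_, ⟨w, rfl⟩, σ'.asGroupHom_apply w⟩
      · rintro ⟨_, ⟨w, rfl⟩, rfl⟩
        exact ⟨w, (σ'.asGroupHom_apply w).symm⟩
    rw [hr]
    exact hτ.image _
  have h1 : σ'.IsSemisimpleRepresentation := isSemisimpleRepresentation_of_finite_range σ' hfinite
  exact (Literature.RepresentationTheory.Semisimple.Representation.isSemisimpleRepresentation_twist_iff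
    σ χ).mp h1

end FrobeniusScalar

end WeilDeligneRep

end Literature.NumberTheory.GaloisRepresentations
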